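import Summits.NavierStokesRegularity.TurbBounds.LayerForm
import Summits.NavierStokesRegularity.TurbBounds.LegendreCoeffs
import HarnessLib

/-!
# Density step: positivity of the layer form on polynomial test fields implies positivity on the one-sided `C² × C¹` class
(cell `pub-turb` / `turb-bounds`; v2 staging of R-T — the 'density remark' of `LayerForm.LayerReduction`'s docstring made a theorem.)

HONEST FRAMING: rigorous bounds for the stated PDE and boundary conditions; no claim about physical turbulence beyond the bound.
`layerForm_nonneg_of_poly`: for any member `(s, κ, η′)` with `η′` continuous and any `K`, if the rescaled layer form SPEC-P2 (1.1)
is `≥ 0` on all real POLYNOMIALS `V, Θ` with `V(-1) = V'(-1) = Θ(-1) = 0`, then it is `≥ 0` on the whole one-sided class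
`OneSided V Θ` (`V ∈ C²(ℝ)`, `Θ ∈ C¹(ℝ)`, same wall conditions). Proof: Weierstrass-approximate `V''` and `Θ'` uniformly on
`[-1, 1]` by polynomials, integrate twice / once from the wall (`LegendreCoeffs.primFrom`), so that `V, V', V'', Θ, Θ'` are all
approximated uniformly; the integrand is a polynomial in these five values with continuous coefficients, hence the forms converge.
-/

set_option linter.style.longLine false

noncomputable section

namespace Summit.NavierStokesRegularity.TurbBounds.LayerDensity

open Polynomial intervalIntegral MeasureTheory Set
open Summit.NavierStokesRegularity.TurbBounds.LayerForm
open Summit.NavierStokesRegularity.TurbBounds.LegendreCoeffs (primFrom derivative_primFrom eval_primFrom_neg_one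
  eval_primFrom_eq_integral)

/-! ## 1. Elementary real inequalities -/

/-- `|y² - x²| ≤ η(2B + η)` when `|x| ≤ B`, `|y - x| ≤ η`. -/
theorem sq_sub_sq_le {x y B η : ℝ} (hx : |x| ≤ B) (hy : |y - x| ≤ η) (hη : 0 ≤ η) :
    |y ^ 2 - x ^ 2| ≤ η * (2 * B + η) := by
  have h1 : y ^ 2 - x ^ 2 = (y - x) * ((y - x) + 2 * x) := by ring
  rw [h1, abs_mul]
  have h2 : |(y - x) + 2 * x| ≤ η + 2 * B := by
    calc |(y - x) + 2 * x| ≤ |y - x| + |2 * x| := abs_add_le _ _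
      _ ≤ η + 2 * B := by rw [abs_mul, abs_two]; linarith
  calc |y - x| * |y - x + 2 * x| ≤ η * (η + 2 * B) := mul_le_mul hy h2 (abs_nonneg _) hη
    _ = η * (2 * B + η) := by ring

/-- `|y v - x u| ≤ η(B + C + η)` when `|x| ≤ B`, `|u| ≤ C`, `|y - x| ≤ η`, `|v - u| ≤ η`. -/
theorem mul_sub_mul_le {x y u v B C η : ℝ} (hx : |x| ≤ B) (hu : |u| ≤ C) (hy : |y - x| ≤ η) (hv : |v - u| ≤ η)
    (hη : 0 ≤ η) : |y * v - x * u| ≤ η * (B + C + η) := by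
  have h1 : y * v - x * u = (y - x) * v + x * (v - u) := by ring
  have hv' : |v| ≤ C + η := by
    have := abs_sub_abs_le_abs_sub v u; linarith
  have hB : 0 ≤ B := le_trans (abs_nonneg _) hx
  rw [h1]
  calc |(y - x) * v + x * (v - u)| ≤ |(y - x) * v| + |x * (v - u)| := abs_add_le _ _
    _ = |y - x| * |v| + |x| * |v - u| := by rw [abs_mul, abs_mul]
    _ ≤ η * (C + η) + B * η :=
        add_le_add (mul_le_mul hy hv' (abs_nonneg _) hη) (mul_le_mul hx hv (abs_nonneg _) hB)
    _ = η * (B + C + η) := by ring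

/-- Triangle inequality for the shape of the layer integrand's difference. -/
theorem abs_comb_le (a b g d2 d1 d0 t1 t0 pr cK c16 : ℝ) :
    |a * (c16 * d2 + 8 * d1 + cK * d0) + b * (4 * t1 + cK * t0) + 2 * g * pr|
      ≤ |a| * (|c16| * |d2| + 8 * |d1| + |cK| * |d0|) + |b| * (4 * |t1| + |cK| * |t0|) + 2 * |g| * |pr| := by
  have h1 : |a * (c16 * d2 + 8 * d1 + cK * d0)| ≤ |a| * (|c16| * |d2| + 8 * |d1| + |cK| * |d0|) := by
    rw [abs_mul]
    refine mul_le_mul_of_nonneg_left ?_ (abs_nonneg _)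
    calc |c16 * d2 + 8 * d1 + cK * d0| ≤ |c16 * d2| + |8 * d1| + |cK * d0| := abs_add_three _ _ _
      _ = |c16| * |d2| + 8 * |d1| + |cK| * |d0| := by
          rw [abs_mul, abs_mul, abs_mul, abs_of_pos (by norm_num : (0 : ℝ) < 8)]
  have h2 : |b * (4 * t1 + cK * t0)| ≤ |b| * (4 * |t1| + |cK| * |t0|) := by
    rw [abs_mul]
    refine mul_le_mul_of_nonneg_left ?_ (abs_nonneg _)
    calc |4 * t1 + cK * t0| ≤ |4 * t1| + |cK * t0| := abs_add_le _ _
      _ = 4 * |t1| + |cK| * |t0| := by rw [abs_mul, abs_mul, abs_of_pos (by norm_num : (0 : ℝ) < 4)]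
  have h3 : |2 * g * pr| = 2 * |g| * |pr| := by rw [abs_mul, abs_mul, abs_two]
  calc |a * (c16 * d2 + 8 * d1 + cK * d0) + b * (4 * t1 + cK * t0) + 2 * g * pr|
      ≤ |a * (c16 * d2 + 8 * d1 + cK * d0)| + |b * (4 * t1 + cK * t0)| + |2 * g * pr| := abs_add_three _ _ _
    _ ≤ _ := by rw [h3]; linarith

/-- `|∫_{-1}^x h| ≤ 2C` when `|h| ≤ C` on `[-1, 1]` and `x ∈ [-1, 1]`. -/
theorem abs_integral_le {h : ℝ → ℝ} {C x : ℝ} (hC : ∀ t ∈ Icc (-1 : ℝ) 1, |h t| ≤ C) (hx : x ∈ Icc (-1 : ℝ) 1) :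
    |∫ t in (-1 : ℝ)..x, h t| ≤ 2 * C := by
  have hC0 : 0 ≤ C := le_trans (abs_nonneg _) (hC (-1) ⟨le_rfl, by norm_num⟩)
  have h1 : ‖∫ t in (-1 : ℝ)..x, h t‖ ≤ C * |x - (-1)| := by
    refine norm_integral_le_of_norm_le_const fun t ht => ?_
    rw [Real.norm_eq_abs]
    rcases Set.mem_uIoc.mp ht with h' | h'
    · exact hC t ⟨h'.1.le, h'.2.trans hx.2⟩
    · exfalso; linarith [h'.1, h'.2, hx.1]
  rw [Real.norm_eq_abs] at h1
  have h2 : |x - (-1)| ≤ 2 := by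
    rw [abs_le]; constructor <;> linarith [hx.1, hx.2]
  calc |∫ t in (-1 : ℝ)..x, h t| ≤ C * |x - (-1)| := h1
    _ ≤ C * 2 := mul_le_mul_of_nonneg_left h2 hC0
    _ = 2 * C := by ring

/-! ## 2. Polynomial approximation of a one-sided pair -/

/-- **Simultaneous uniform approximation.** For `(V, Θ)` in the one-sided class and `δ > 0` there are polynomials `Vp, Θp` with
the same wall conditions such that on `[-1, 1]`: `|Vp'' - V''| ≤ δ`, `|Vp' - V'| ≤ 2δ`, `|Vp - V| ≤ 4δ`, `|Θp' - Θ'| ≤ δ`,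
`|Θp - Θ| ≤ 2δ`. -/
theorem exists_poly_approx {V Θ : ℝ → ℝ} (hVΘ : OneSided V Θ) {δ : ℝ} (hδ : 0 < δ) :
    ∃ Vp Θp : ℝ[X], Vp.eval (-1) = 0 ∧ (derivative Vp).eval (-1) = 0 ∧ Θp.eval (-1) = 0 ∧
      (∀ x ∈ Icc (-1 : ℝ) 1, |(derivative (derivative Vp)).eval x - deriv (deriv V) x| ≤ δ) ∧
      (∀ x ∈ Icc (-1 : ℝ) 1, |(derivative Vp).eval x - deriv V x| ≤ 2 * δ) ∧
      (∀ x ∈ Icc (-1 : ℝ) 1, |Vp.eval x - V x| ≤ 4 * δ) ∧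
      (∀ x ∈ Icc (-1 : ℝ) 1, |(derivative Θp).eval x - deriv Θ x| ≤ δ) ∧
      (∀ x ∈ Icc (-1 : ℝ) 1, |Θp.eval x - Θ x| ≤ 2 * δ) := by
  have hV : ContDiff ℝ 2 V := hVΘ.hV
  have hΘ : ContDiff ℝ 1 Θ := hVΘ.hΘ
  have hV0d : Differentiable ℝ V := hV.differentiable (by norm_num)
  have hV1d : Differentiable ℝ (deriv V) := by
    have h := hV.differentiable_iteratedDeriv 1 (by norm_num)
    rwa [iteratedDeriv_one] at h
  have hV1c : Continuous (deriv V) := hV.continuous_deriv (by norm_num)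
  have hV2c : Continuous (deriv (deriv V)) := by
    have h := hV.continuous_iteratedDeriv 2 (by norm_num)
    rwa [iteratedDeriv_succ, iteratedDeriv_one] at h
  have hΘ0d : Differentiable ℝ Θ := hΘ.differentiable (by norm_num)
  have hΘ1c : Continuous (deriv Θ) := hΘ.continuous_deriv (by norm_num)
  -- Weierstrass on V'' and Θ'
  obtain ⟨p, hp⟩ := exists_polynomial_near_of_continuousOn (-1 : ℝ) 1 (deriv (deriv V)) hV2c.continuousOn δ hδ
  obtain ⟨q, hq⟩ := exists_polynomial_near_of_continuousOn (-1 : ℝ) 1 (deriv Θ) hΘ1c.continuousOn δ hδ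
  -- integrate from the wall
  set P1 := primFrom p with hP1
  set Vp := primFrom P1 with hVp
  set Θp := primFrom q with hΘp
  have hVp' : derivative Vp = P1 := by rw [hVp, derivative_primFrom]
  have hVp'' : derivative (derivative Vp) = p := by rw [hVp', hP1, derivative_primFrom]
  have hΘp' : derivative Θp = q := by rw [hΘp, derivative_primFrom]
  -- FTC for V', V, Θ from the wall
  have ftcV1 : ∀ x, deriv V x = ∫ t in (-1 : ℝ)..x, deriv (deriv V) t := by
    intro x
    rw [integral_eq_sub_of_hasDerivAt (fun t _ => (hV1d t).hasDerivAt) (hV2c.intervalIntegrable _ _),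
      hVΘ.dV_wall, sub_zero]
  have ftcV0 : ∀ x, V x = ∫ t in (-1 : ℝ)..x, deriv V t := by
    intro x
    rw [integral_eq_sub_of_hasDerivAt (fun t _ => (hV0d t).hasDerivAt) (hV1c.intervalIntegrable _ _),
      hVΘ.V_wall, sub_zero]
  have ftcΘ : ∀ x, Θ x = ∫ t in (-1 : ℝ)..x, deriv Θ t := by
    intro x
    rw [integral_eq_sub_of_hasDerivAt (fun t _ => (hΘ0d t).hasDerivAt) (hΘ1c.intervalIntegrable _ _),
      hVΘ.Θ_wall, sub_zero]
  -- error bounds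
  have e2 : ∀ x ∈ Icc (-1 : ℝ) 1, |(derivative (derivative Vp)).eval x - deriv (deriv V) x| ≤ δ := by
    intro x hx; rw [hVp'']; exact (hp x hx).le
  have e1 : ∀ x ∈ Icc (-1 : ℝ) 1, |(derivative Vp).eval x - deriv V x| ≤ 2 * δ := by
    intro x hx
    rw [hVp', hP1, eval_primFrom_eq_integral, ftcV1 x,
      ← intervalIntegral.integral_sub (p.continuous.intervalIntegrable _ _) (hV2c.intervalIntegrable _ _)]
    exact abs_integral_le (fun t ht => by have h := e2 t ht; rwa [hVp''] at h) hx
  have e0 : ∀ x ∈ Icc (-1 : ℝ) 1, |Vp.eval x - V x| ≤ 4 * δ := by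
    intro x hx
    rw [hVp, eval_primFrom_eq_integral, ftcV0 x,
      ← intervalIntegral.integral_sub (P1.continuous.intervalIntegrable _ _) (hV1c.intervalIntegrable _ _)]
    have h := abs_integral_le (C := 2 * δ) (fun t ht => by have h := e1 t ht; rwa [hVp'] at h) hx
    linarith
  have f1 : ∀ x ∈ Icc (-1 : ℝ) 1, |(derivative Θp).eval x - deriv Θ x| ≤ δ := by
    intro x hx; rw [hΘp']; exact (hq x hx).le
  have f0 : ∀ x ∈ Icc (-1 : ℝ) 1, |Θp.eval x - Θ x| ≤ 2 * δ := by
    intro x hx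
    rw [hΘp, eval_primFrom_eq_integral, ftcΘ x,
      ← intervalIntegral.integral_sub (q.continuous.intervalIntegrable _ _) (hΘ1c.intervalIntegrable _ _)]
    exact abs_integral_le (fun t ht => by have h := f1 t ht; rwa [hΘp'] at h) hx
  refine ⟨Vp, Θp, ?_, ?_, ?_, e2, e1, e0, f1, f0⟩
  · rw [hVp]; exact eval_primFrom_neg_one _
  · rw [hVp', hP1]; exact eval_primFrom_neg_one _
  · rw [hΘp]; exact eval_primFrom_neg_one _

/-! ## 3. The density theorem -/

/-- **Density.** If the layer form of the member `(s, κ, η′)` (`η′` continuous) at the datum `K` is `≥ 0` on all polynomial test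
fields with the one-sided wall conditions, it is `≥ 0` on the whole one-sided `C² × C¹` class. -/
theorem layerForm_nonneg_of_poly {s κ K : ℝ} {ηp : ℝ → ℝ} (hη : Continuous ηp)
    (hpoly : ∀ Vp Θp : ℝ[X], Vp.eval (-1) = 0 → (derivative Vp).eval (-1) = 0 → Θp.eval (-1) = 0 →
      0 ≤ layerForm s κ ηp K (fun x => Vp.eval x) (fun x => Θp.eval x))
    {V Θ : ℝ → ℝ} (hVΘ : OneSided V Θ) : 0 ≤ layerForm s κ ηp K V Θ := by
  have hV : ContDiff ℝ 2 V := hVΘ.hV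
  have hΘ : ContDiff ℝ 1 Θ := hVΘ.hΘ
  have hV0c : Continuous V := (hV.differentiable (by norm_num)).continuous
  have hV1c : Continuous (deriv V) := hV.continuous_deriv (by norm_num)
  have hV2c : Continuous (deriv (deriv V)) := by
    have h := hV.continuous_iteratedDeriv 2 (by norm_num)
    rwa [iteratedDeriv_succ, iteratedDeriv_one] at h
  have hΘ0c : Continuous Θ := (hΘ.differentiable (by norm_num)).continuous
  have hΘ1c : Continuous (deriv Θ) := hΘ.continuous_deriv (by norm_num)
  have hgc : Continuous (gOf s κ ηp) := by unfold gOf; fun_prop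
  -- bounds on [-1, 1]
  obtain ⟨B2, hB2⟩ := isCompact_Icc.exists_bound_of_continuousOn (hV2c.continuousOn (s := Icc (-1 : ℝ) 1))
  obtain ⟨B1, hB1⟩ := isCompact_Icc.exists_bound_of_continuousOn (hV1c.continuousOn (s := Icc (-1 : ℝ) 1))
  obtain ⟨B0, hB0⟩ := isCompact_Icc.exists_bound_of_continuousOn (hV0c.continuousOn (s := Icc (-1 : ℝ) 1))
  obtain ⟨G1, hG1⟩ := isCompact_Icc.exists_bound_of_continuousOn (hΘ1c.continuousOn (s := Icc (-1 : ℝ) 1))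
  obtain ⟨G0, hG0⟩ := isCompact_Icc.exists_bound_of_continuousOn (hΘ0c.continuousOn (s := Icc (-1 : ℝ) 1))
  obtain ⟨Tg, hTg⟩ := isCompact_Icc.exists_bound_of_continuousOn (hgc.continuousOn (s := Icc (-1 : ℝ) 1))
  simp only [Real.norm_eq_abs] at hB2 hB1 hB0 hG1 hG0 hTg
  have m1 : (-1 : ℝ) ∈ Icc (-1 : ℝ) 1 := ⟨le_rfl, by norm_num⟩
  have hB2n : 0 ≤ B2 := le_trans (abs_nonneg _) (hB2 _ m1)
  have hB1n : 0 ≤ B1 := le_trans (abs_nonneg _) (hB1 _ m1)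
  have hB0n : 0 ≤ B0 := le_trans (abs_nonneg _) (hB0 _ m1)
  have hG1n : 0 ≤ G1 := le_trans (abs_nonneg _) (hG1 _ m1)
  have hG0n : 0 ≤ G0 := le_trans (abs_nonneg _) (hG0 _ m1)
  have hTgn : 0 ≤ Tg := le_trans (abs_nonneg _) (hTg _ m1)
  -- the constant
  set Cst : ℝ := |s - 1| * (|16 / K| * (2 * B2 + 4) + 8 * (2 * B1 + 4) + |K| * (2 * B0 + 4))
      + |s| * (4 * (2 * G1 + 4) + |K| * (2 * G0 + 4)) + 2 * Tg * (B0 + G0 + 4) with hCst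
  have hCst0 : 0 ≤ Cst := by rw [hCst]; positivity
  -- argue by contradiction
  by_contra hneg
  have hneg : layerForm s κ ηp K V Θ < 0 := not_le.mp hneg
  set F := layerForm s κ ηp K V Θ with hF
  -- choose δ
  obtain ⟨δ, hδ0, hδ1, hδF⟩ : ∃ δ : ℝ, 0 < δ ∧ δ ≤ 1 ∧ 8 * δ * Cst < -F := by
    refine ⟨min 1 (-F / (8 * Cst + 8)), ?_, min_le_left _ _, ?_⟩
    · refine lt_min one_pos (div_pos (by linarith) (by positivity))
    · have hle : min 1 (-F / (8 * Cst + 8)) ≤ -F / (8 * Cst + 8) := min_le_right _ _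
      have hpos : 0 < 8 * Cst + 8 := by positivity
      calc 8 * min 1 (-F / (8 * Cst + 8)) * Cst ≤ 8 * (-F / (8 * Cst + 8)) * Cst := by gcongr
        _ < -F := by
            rw [div_eq_mul_inv]
            have : 8 * (-F * (8 * Cst + 8)⁻¹) * Cst = -F * (8 * Cst / (8 * Cst + 8)) := by ring
            rw [this]
            have hlt : 8 * Cst / (8 * Cst + 8) < 1 := by rw [div_lt_one hpos]; linarith
            have hFpos : 0 < -F := by linarith
            nlinarith
  obtain ⟨Vp, Θp, hV0, hV1, hΘ0, e2, e1, e0, f1, f0⟩ := exists_poly_approx hVΘ hδ0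
  have hpos := hpoly Vp Θp hV0 hV1 hΘ0
  -- pointwise bound on the integrands
  set η := 4 * δ with hη
  have hη0 : 0 ≤ η := by rw [hη]; linarith
  have hη4 : η ≤ 4 := by rw [hη]; linarith
  have hdV : deriv (fun x => Vp.eval x) = fun x => (derivative Vp).eval x := by funext x; exact Polynomial.deriv Vp
  have hdV1 : deriv (fun x => (derivative Vp).eval x) = fun x => (derivative (derivative Vp)).eval x := by
    funext x; exact Polynomial.deriv (derivative Vp)
  have hdΘ : deriv (fun x => Θp.eval x) = fun x => (derivative Θp).eval x := by funext x; exact Polynomial.deriv Θp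
  have hpt : ∀ x ∈ Icc (-1 : ℝ) 1,
      |layerIntegrand s κ ηp K (fun x => Vp.eval x) (fun x => Θp.eval x) x - layerIntegrand s κ ηp K V Θ x| ≤ η * Cst := by
    intro x hx
    have d2 := sq_sub_sq_le (hB2 x hx) ((e2 x hx).trans (by linarith : δ ≤ η)) hη0
    have d1 := sq_sub_sq_le (hB1 x hx) ((e1 x hx).trans (by linarith : 2 * δ ≤ η)) hη0
    have d0 := sq_sub_sq_le (hB0 x hx) ((e0 x hx).trans (le_of_eq hη.symm)) hη0
    have t1 := sq_sub_sq_le (hG1 x hx) ((f1 x hx).trans (by linarith : δ ≤ η)) hη0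
    have t0 := sq_sub_sq_le (hG0 x hx) ((f0 x hx).trans (by linarith : 2 * δ ≤ η)) hη0
    have pr := mul_sub_mul_le (hB0 x hx) (hG0 x hx) ((e0 x hx).trans (le_of_eq hη.symm))
      ((f0 x hx).trans (by linarith : 2 * δ ≤ η)) hη0
    have hg := hTg x hx
    have hdiff : layerIntegrand s κ ηp K (fun x => Vp.eval x) (fun x => Θp.eval x) x - layerIntegrand s κ ηp K V Θ x
        = (s - 1) * (16 / K * ((derivative (derivative Vp)).eval x ^ 2 - deriv (deriv V) x ^ 2)
            + 8 * ((derivative Vp).eval x ^ 2 - deriv V x ^ 2) + K * (Vp.eval x ^ 2 - V x ^ 2))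
          + s * (4 * ((derivative Θp).eval x ^ 2 - deriv Θ x ^ 2) + K * (Θp.eval x ^ 2 - Θ x ^ 2))
          + 2 * gOf s κ ηp x * (Vp.eval x * Θp.eval x - V x * Θ x) := by
      simp only [layerIntegrand, hdV, hdV1, hdΘ]
      ring
    rw [hdiff]
    refine (abs_comb_le _ _ _ _ _ _ _ _ _ _ _).trans ?_
    have hs1 := abs_nonneg (s - 1)
    have hs0 := abs_nonneg s
    have hK0 := abs_nonneg K
    have h16 := abs_nonneg (16 / K)
    calc |s - 1| * (|16 / K| * |(derivative (derivative Vp)).eval x ^ 2 - deriv (deriv V) x ^ 2|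
            + 8 * |(derivative Vp).eval x ^ 2 - deriv V x ^ 2| + |K| * |Vp.eval x ^ 2 - V x ^ 2|)
          + |s| * (4 * |(derivative Θp).eval x ^ 2 - deriv Θ x ^ 2| + |K| * |Θp.eval x ^ 2 - Θ x ^ 2|)
          + 2 * |gOf s κ ηp x| * |Vp.eval x * Θp.eval x - V x * Θ x|
        ≤ |s - 1| * (|16 / K| * (η * (2 * B2 + η)) + 8 * (η * (2 * B1 + η)) + |K| * (η * (2 * B0 + η)))
          + |s| * (4 * (η * (2 * G1 + η)) + |K| * (η * (2 * G0 + η)))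
          + 2 * Tg * (η * (B0 + G0 + η)) := by
          gcongr
      _ ≤ |s - 1| * (|16 / K| * (η * (2 * B2 + 4)) + 8 * (η * (2 * B1 + 4)) + |K| * (η * (2 * B0 + 4)))
          + |s| * (4 * (η * (2 * G1 + 4)) + |K| * (η * (2 * G0 + 4)))
          + 2 * Tg * (η * (B0 + G0 + 4)) := by
          gcongr
      _ = η * Cst := by rw [hCst]; ring
  -- integrate the pointwise bound
  have hIp : Continuous (layerIntegrand s κ ηp K (fun x => Vp.eval x) (fun x => Θp.eval x)) := by
    have : layerIntegrand s κ ηp K (fun x => Vp.eval x) (fun x => Θp.eval x)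
        = fun x => (s - 1) * (16 * ((derivative (derivative Vp)).eval x) ^ 2 / K + 8 * ((derivative Vp).eval x) ^ 2
            + K * (Vp.eval x) ^ 2) + s * (4 * ((derivative Θp).eval x) ^ 2 + K * (Θp.eval x) ^ 2)
            + 2 * gOf s κ ηp x * Vp.eval x * Θp.eval x := by
      funext x; simp only [layerIntegrand, hdV, hdV1, hdΘ]
    rw [this]; fun_prop
  have hI : Continuous (layerIntegrand s κ ηp K V Θ) := by
    have : layerIntegrand s κ ηp K V Θ
        = fun x => (s - 1) * (16 * (deriv (deriv V) x) ^ 2 / K + 8 * (deriv V x) ^ 2 + K * (V x) ^ 2)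
            + s * (4 * (deriv Θ x) ^ 2 + K * (Θ x) ^ 2) + 2 * gOf s κ ηp x * V x * Θ x := by
      funext x; simp only [layerIntegrand]
    rw [this]
    exact ((continuous_const.mul (((continuous_const.mul (hV2c.pow 2)).div_const K |>.add
      (continuous_const.mul (hV1c.pow 2))).add (continuous_const.mul (hV0c.pow 2)))).add
      (continuous_const.mul ((continuous_const.mul (hΘ1c.pow 2)).add (continuous_const.mul (hΘ0c.pow 2))))).add
      (((continuous_const.mul hgc).mul hV0c).mul hΘ0c)
  have hdiffInt : |layerForm s κ ηp K (fun x => Vp.eval x) (fun x => Θp.eval x) - F| ≤ 2 * (η * Cst) := by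
    rw [hF]
    unfold layerForm
    rw [← intervalIntegral.integral_sub (hIp.intervalIntegrable _ _) (hI.intervalIntegrable _ _)]
    have h1 : ‖∫ x in (-1 : ℝ)..1, (layerIntegrand s κ ηp K (fun x => Vp.eval x) (fun x => Θp.eval x) x
        - layerIntegrand s κ ηp K V Θ x)‖ ≤ (η * Cst) * |1 - (-1)| := by
      refine norm_integral_le_of_norm_le_const fun t ht => ?_
      rw [Real.norm_eq_abs]
      rcases Set.mem_uIoc.mp ht with h' | h'
      · exact hpt t ⟨h'.1.le, h'.2⟩
      · exfalso; linarith [h'.1, h'.2]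
    rw [Real.norm_eq_abs] at h1
    have : |(1 : ℝ) - (-1)| = 2 := by norm_num
    rw [this] at h1
    linarith
  have hFin : F < 0 := hneg
  have : 2 * (η * Cst) = 8 * δ * Cst := by rw [hη]; ring
  rw [this] at hdiffInt
  have := abs_le.mp hdiffInt
  linarith [this.1, this.2, hpos, hδF]

end Summit.NavierStokesRegularity.TurbBounds.LayerDensity

end
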